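import Literature.NumberTheory.Transcendental.KZLogCalculusProofs
import Summits.KontsevichZagierPeriods.KontsevichZagierPeriods.Theorems.LiouvilleUnfoldingCVSQuarter

/-!
# Route ValuedFieldSpecialisation — crux `ParametricLifting` (stmt-KontsevichZagierPeriods-3498):
the Frullani calibration, stub `frullani_fibreRelation` (the special-fibre relation)

In the Frullani sector of the regularised lifting mechanism (lead c6) the special fibres of the
three dominated families are `r = ((0,1], 1/((1+t)(1+2t)))`, `d₀ = ([1,2], 1/v)` and
`n₀ = ([1,2], 1/(v(1+v)))`, and the comparison with the target `r' = ([1,2], 1/(1+v))` is ONE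
integrand-additivity move on the common domain `[1,2] ⊆ ℝ¹`:

  `1/v = 1/(1+v) + 1/(v(1+v))`  (`1 ≤ v ≤ 2`),

i.e. `[d₀] − [r'] − [n₀] ∈ KZ.integrandAddRel`. Here we CONSTRUCT `r'` (domain `[1,2]`, integrand
`(1 + x 0)⁻¹`, continuous on the compact segment, of KZ's rational shape `1 / (1 + X₀)`) and record
the move. The base segment `[1,2] ⊆ ℝ¹` (semialgebraic, compact) is reused from the
Cresson–Viu-Sos calibration (`LiouvilleUnfolding.Calibration.isSemialgebraic_base`, `isCompact_base`).

Sources: M. Kontsevich, D. Zagier, *Periods* (2001), §1.2 rule (1). No new definitions.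
-/

noncomputable section

namespace Summit.KontsevichZagierPeriods.ValuedFieldSpecialisation

open MeasureTheory Set Filter
open scoped Topology
open Literature.NumberTheory.Transcendental Literature.NumberTheory.Transcendental.KZ
open Literature.ModelTheory.ExponentialFields (IsSemialgebraic isSemialgebraic_setOf_eval_pos
  isSemialgebraic_setOf_eval_lt isSemialgebraic_setOf_eval_le)
open Summit.KontsevichZagierPeriods.LiouvilleUnfolding.Calibration (isSemialgebraic_base
  isCompact_base)

/-- **The target representation `r' = ([1,2], 1/(1+v))` of the Frullani pair**: an integral
representation in dimension `1` with domain `[1,2]`, integrand `(1 + x 0)⁻¹` (continuous on the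
compact segment, hence integrable) and KZ's rational shape `1 / (1 + X₀)`.
[Kontsevich–Zagier 2001, §1.1] [folklore] -/
theorem frullani_exists_targetRep :
    ∃ r' : KZ.IntegralRep 1, r'.domain = {x | 1 ≤ x 0 ∧ x 0 ≤ 2} ∧
      (r'.integrand = fun x => (1 + x 0)⁻¹) ∧ r'.IsRational := by
  have hne : ∀ x ∈ {x : Fin 1 → ℝ | 1 ≤ x 0 ∧ x 0 ≤ 2}, (1 + x 0 : ℝ) ≠ 0 := by
    intro x hx
    have hx1 : 1 ≤ x 0 := hx.1
    positivity
  have hq : ∀ x ∈ {x : Fin 1 → ℝ | 1 ≤ x 0 ∧ x 0 ≤ 2},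
      MvPolynomial.aeval x (1 + MvPolynomial.X (0 : Fin 1) : MvPolynomial (Fin 1) ℚ) ≠ 0 := by
    intro x hx
    simpa using hne x hx
  have hsa : IsSemialgebraicFunOn ℚ {x : Fin 1 → ℝ | 1 ≤ x 0 ∧ x 0 ≤ 2}
      (fun x : Fin 1 → ℝ => (1 + x 0)⁻¹) :=
    (isSemialgebraicFunOn_aeval_div_aeval isSemialgebraic_base 1 (1 + MvPolynomial.X 0) hq).congr
      fun x _ => by simp
  have hint : IntegrableOn (fun x : Fin 1 → ℝ => (1 + x 0)⁻¹)
      {x : Fin 1 → ℝ | 1 ≤ x 0 ∧ x 0 ≤ 2} :=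
    ContinuousOn.integrableOn_compact isCompact_base
      (ContinuousOn.inv₀ (by fun_prop) hne)
  refine ⟨⟨{x | 1 ≤ x 0 ∧ x 0 ≤ 2}, fun x => (1 + x 0)⁻¹, isSemialgebraic_base, hsa, hint⟩, rfl, rfl,
    1, 1 + MvPolynomial.X 0, hq, fun x _ => ?_⟩
  simp

/-- **Stub G (the special-fibre relation `1/v = 1/(1+v) + 1/(v(1+v))` on `[1,2]`).** For the
special fibres `d₀ = ([1,2], 1/v)` and `n₀ = ([1,2], 1/(v(1+v)))` of the Frullani calibration there
is a target representation `r' = ([1,2], 1/(1+v))` of KZ's rational shape with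
`[d₀] − [r'] − [n₀] ∈ KZ.integrandAddRel` (one integrand-additivity move on the common domain).
[Kontsevich–Zagier 2001, §1.2 rule (1)] [folklore] -/
theorem frullani_fibreRelation :
    ∀ (d₀ n₀ : KZ.IntegralRep 1), d₀.domain = {x | 1 ≤ x 0 ∧ x 0 ≤ 2} → (d₀.integrand = fun x => (x 0)⁻¹) → n₀.domain = {x | 1 ≤ x 0 ∧ x 0 ≤ 2} → (n₀.integrand = fun x => (x 0 * (1 + x 0))⁻¹) → ∃ r' : KZ.IntegralRep 1, r'.domain = {x | 1 ≤ x 0 ∧ x 0 ≤ 2} ∧ (r'.integrand = fun x => (1 + x 0)⁻¹) ∧ r'.IsRational ∧ KZ.of d₀ - KZ.of r' - KZ.of n₀ ∈ KZ.integrandAddRel := by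
  intro d₀ n₀ hd₀d hd₀i hn₀d hn₀i
  obtain ⟨r', hr'd, hr'i, hrat⟩ := frullani_exists_targetRep
  refine ⟨r', hr'd, hr'i, hrat, 1, d₀, r', n₀, by rw [hr'd, hd₀d], by rw [hn₀d, hd₀d], ?_, rfl⟩
  intro x hx
  rw [hd₀d] at hx
  have hx1 : 1 ≤ x 0 := hx.1
  have h0 : (x 0) ≠ 0 := by positivity
  have h1 : (1 + x 0) ≠ 0 := by positivity
  simp only [Pi.add_apply, hd₀i, hr'i, hn₀i]
  field_simp
  ring

end Summit.KontsevichZagierPeriods.ValuedFieldSpecialisation
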